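import Mathlib
import Literature.NumberTheory.Sieve.Maynard2016QSystemRad
import HarnessLib

/-!
# Maynard (2016), Lemma 7: the `q`-system is empty or ONE COPRIME class modulo `r` — p. 12

Trunk: AntSieve / parity (Maynard 2016 large-gaps ladder; named fact
`Literature.NumberTheory.Sieve.Maynard2016.Lemma7Tuple`).

J. Maynard, *Large gaps between primes*, Ann. of Math. 183 (2016) = arXiv:1408.5110, §6, proof of
Lemma 7, p. 12: "We see that the inner sum over `q` is empty unless … Moreover, we must also have
[(Div1)–(Div3)]. If all of these conditions are satisfied, then the inner sum can be rewritten as a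
sum over primes in `𝓘_m` in a single residue class modulo the least common multiple … Moreover,
this residue class will be coprime to the modulus."

PROVED here (generic squarefree linear systems `D_t ∣ P_t + A_t q`, `t ∈ s`; the two Lemma-7
mechanisms that make the coefficients units are supplied as the dischargers
`Maynard2016QSystem.isCoprime_of_intDvd_linear_prime` (`d`-side: `P = p₀` prime `> D`) and
`isCoprime_of_intDvd_linear_of_isCoprime` below (`e`-side: `P = m p₀ − 1` coprime to `A`)):
* `linearSystem_empty_or_class` — EITHER no `q ∈ ℕ` solves the system, OR the solutions are exactly
  one residue class `c (mod R)`, `R = ∏_{p ∣ ∏ D_t} p` the radical (compatibility (Div) being forced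
  by solvability, `Maynard2016QSystemRad.compat_of_intDvd_linear_pair`);
* `linearSystem_empty_or_coprime_class` — if moreover no prime of a modulus divides its constant
  term `P_t`, that class is coprime to `R` ("this residue class will be coprime to the modulus");
* `filter_eq_empty_or_eq_filter_mod` — the finset form used on `q ∈ 𝓘_m`.

## References

* J. Maynard, *Large gaps between primes*, Ann. of Math. (2) 183 (2016), 915–933; arXiv:1408.5110,
  §6, proof of Lemma 7, p. 12. [Maynard2016LargeGaps]
-/

open Finset
open scoped BigOperators

namespace Literature.NumberTheory.Sieve

namespace Maynard2016

/-- **`e`-side discharger**: if `E ∣ N + B q` for some `q` and `gcd(N, B) = 1`, then `gcd(B, E) = 1`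
(in Lemma 7: `N = m p₀ − 1`, `B = m (h_j − h_i)`, and `(m p₀ − 1, m (h_j − h_i)) = 1` because `p₀ ∈ 𝓡_m`).
[cite: Maynard2016LargeGaps, Lemma 7 (proof, p. 12)] -/
theorem isCoprime_of_intDvd_linear_of_isCoprime {E : ℕ} {N B : ℤ} (hNB : IsCoprime N B) {q : ℕ}
    (h : (E : ℤ) ∣ N + B * q) : IsCoprime B (E : ℤ) := by
  refine isCoprime_of_gcd_dvd_of_isCoprime ?_ hNB
  have hgE : ((Int.gcd B E : ℕ) : ℤ) ∣ (E : ℤ) := Int.gcd_dvd_right _ _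
  have hgB : ((Int.gcd B E : ℕ) : ℤ) ∣ B := Int.gcd_dvd_left _ _
  exact (dvd_add_left (hgB.mul_right (q : ℤ))).1 (hgE.trans h)

/-- **Empty or one class**: for squarefree moduli `D_t` and coefficients which are units whenever the
`t`-th condition is solvable at all, either no `q` solves the system or its solution set is one
residue class modulo the radical `R = ∏_{p ∣ ∏ D_t} p`. [cite: Maynard2016LargeGaps, Lemma 7 (proof, p. 12)] -/
theorem linearSystem_empty_or_class {ι : Type*} (s : Finset ι) (D : ι → ℕ) (P A : ι → ℤ)
    (hsq : ∀ t ∈ s, Squarefree (D t))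
    (hunit : ∀ t ∈ s, ∀ q : ℕ, (D t : ℤ) ∣ P t + A t * q → IsCoprime (A t) (D t : ℤ)) :
    (∀ q : ℕ, ¬ ∀ t ∈ s, (D t : ℤ) ∣ P t + A t * q) ∨
      ∃ c, c < ∏ p ∈ (∏ t ∈ s, D t).primeFactors, p ∧
        ∀ q : ℕ, (∀ t ∈ s, (D t : ℤ) ∣ P t + A t * q) ↔
          q % (∏ p ∈ (∏ t ∈ s, D t).primeFactors, p) = c := by
  classical
  by_cases hsol : ∃ q₀ : ℕ, ∀ t ∈ s, (D t : ℤ) ∣ P t + A t * q₀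
  · obtain ⟨q₀, hq₀⟩ := hsol
    right
    have hA : ∀ t ∈ s, IsCoprime (A t) (D t : ℤ) := fun t ht => hunit t ht q₀ (hq₀ t ht)
    have hcompat : ∀ p : ℕ, p.Prime → ∀ t₁ ∈ s, ∀ t₂ ∈ s, p ∣ D t₁ → p ∣ D t₂ →
        (p : ℤ) ∣ A t₂ * P t₁ - A t₁ * P t₂ := by
      intro p _ t₁ ht₁ t₂ ht₂ hp₁ hp₂
      exact compat_of_intDvd_linear_pair ((Int.natCast_dvd_natCast.2 hp₁).trans (hq₀ t₁ ht₁))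
        ((Int.natCast_dvd_natCast.2 hp₂).trans (hq₀ t₂ ht₂))
    exact exists_sqfSystem_iff_mod_eq s D P A hsq hA hcompat
  · left
    intro q hq
    exact hsol ⟨q, hq⟩

/-- **"This residue class will be coprime to the modulus"**: if in addition no prime of `D_t`
divides the constant term `P_t` (in Lemma 7: `p ∣ [d_j,d'_j] ⇒ p < p₀ = P`, and
`p ∣ [e_j,e'_j] ⇒ p ≤ y ⇒ p ∤ m p₀ − 1`), the class `c` is coprime to `R`.
[cite: Maynard2016LargeGaps, Lemma 7 (proof, p. 12)] -/
theorem linearSystem_empty_or_coprime_class {ι : Type*} (s : Finset ι) (D : ι → ℕ) (P A : ι → ℤ)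
    (hsq : ∀ t ∈ s, Squarefree (D t))
    (hunit : ∀ t ∈ s, ∀ q : ℕ, (D t : ℤ) ∣ P t + A t * q → IsCoprime (A t) (D t : ℤ))
    (hP : ∀ t ∈ s, ∀ p : ℕ, p.Prime → p ∣ D t → ¬ (p : ℤ) ∣ P t) :
    (∀ q : ℕ, ¬ ∀ t ∈ s, (D t : ℤ) ∣ P t + A t * q) ∨
      ∃ c, c < ∏ p ∈ (∏ t ∈ s, D t).primeFactors, p ∧
        c.Coprime (∏ p ∈ (∏ t ∈ s, D t).primeFactors, p) ∧
        ∀ q : ℕ, (∀ t ∈ s, (D t : ℤ) ∣ P t + A t * q) ↔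
          q % (∏ p ∈ (∏ t ∈ s, D t).primeFactors, p) = c := by
  classical
  rcases linearSystem_empty_or_class s D P A hsq hunit with h | ⟨c, hc, hiff⟩
  · exact Or.inl h
  · refine Or.inr ⟨c, hc, ?_, hiff⟩
    set R := ∏ p ∈ (∏ t ∈ s, D t).primeFactors, p with hR
    -- `c` itself solves the system
    have hcsys : ∀ t ∈ s, (D t : ℤ) ∣ P t + A t * c := (hiff c).2 (Nat.mod_eq_of_lt hc)
    have hD0 : ∀ t ∈ s, D t ≠ 0 := fun t ht => (hsq t ht).ne_zero
    have hprod0 : ∏ t ∈ s, D t ≠ 0 := Finset.prod_ne_zero_iff.2 hD0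
    refine Nat.coprime_of_dvd fun p hp hpc hpR => ?_
    -- a prime `p ∣ R` divides some `D t`
    have hpprod : p ∣ ∏ t ∈ s, D t := hpR.trans (Nat.prod_primeFactors_dvd _)
    obtain ⟨t, ht, hpt⟩ := (Prime.dvd_finsetProd_iff hp.prime _).1 hpprod
    have h1 : (p : ℤ) ∣ P t + A t * c := (Int.natCast_dvd_natCast.2 hpt).trans (hcsys t ht)
    have h2 : (p : ℤ) ∣ A t * c := (Int.natCast_dvd_natCast.2 hpc).mul_left _
    exact hP t ht p hp hpt ((dvd_add_left h2).1 h1)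

/-- **Finset form** (for the `q`-sum over `𝓘_m`): for any finite set `Q` of candidate `q`, the
subset cut out by the system is either empty or equal to the subset `{q ∈ Q : q % R = c % R}` of one
class `c` coprime to `R` (so that `Maynard2016Lemma7ClassCount` applies). [cite: Maynard2016LargeGaps, Lemma 7 (proof, p. 12)] -/
theorem filter_eq_empty_or_eq_filter_mod {ι : Type*} (s : Finset ι) (D : ι → ℕ) (P A : ι → ℤ)
    (hsq : ∀ t ∈ s, Squarefree (D t))
    (hunit : ∀ t ∈ s, ∀ q : ℕ, (D t : ℤ) ∣ P t + A t * q → IsCoprime (A t) (D t : ℤ))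
    (hP : ∀ t ∈ s, ∀ p : ℕ, p.Prime → p ∣ D t → ¬ (p : ℤ) ∣ P t) (Q : Finset ℕ)
    [DecidablePred fun q : ℕ => ∀ t ∈ s, (D t : ℤ) ∣ P t + A t * q] :
    Q.filter (fun q : ℕ => ∀ t ∈ s, (D t : ℤ) ∣ P t + A t * (q : ℤ)) = ∅ ∨
      ∃ c, c < ∏ p ∈ (∏ t ∈ s, D t).primeFactors, p ∧
        c.Coprime (∏ p ∈ (∏ t ∈ s, D t).primeFactors, p) ∧
        Q.filter (fun q : ℕ => ∀ t ∈ s, (D t : ℤ) ∣ P t + A t * (q : ℤ)) =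
          Q.filter (fun q : ℕ => q % (∏ p ∈ (∏ t ∈ s, D t).primeFactors, p) =
            c % (∏ p ∈ (∏ t ∈ s, D t).primeFactors, p)) := by
  classical
  rcases linearSystem_empty_or_coprime_class s D P A hsq hunit hP with h | ⟨c, hc, hcop, hiff⟩
  · left
    exact Finset.filter_eq_empty_iff.2 fun q _ hq => h q hq
  · refine Or.inr ⟨c, hc, hcop, ?_⟩
    rw [Nat.mod_eq_of_lt hc]
    exact Finset.filter_congr fun q _ => hiff q

end Maynard2016

end Literature.NumberTheory.Sieve
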